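import Summits.HodgeConjecture.HodgeConjecture.Theorems.SignSymmetricPowersSignEigenHodgeOfGeometricGenus
import HarnessLib

/-!
# The `ι`-eigen-Hodge numbers of a smooth sign-symmetric threefold from the BOUND `h^{3,0}(X_f) ≤ C(d−1,4)` alone
# (route `SignSymmetricPowers`, item stmt-HodgeConjecture-19716, binder hV; cell `hodge-nonav`)

Prover seat `hodge-nonav-19716-p2` (g5). Landed `--supports stmt-HodgeConjecture-19716 --as helper`; sorry-free, no
definition, no new named fact. Route-owner request (P3 g30, STATUS 11:02:15Z): phrase the `q = 0, 3` input of
`SignSymmetricPowersSignEigenHodgeOfGeometricGenus.finrank_signEigenspace_inf_piece_of_geometricGenus` as the WEAKER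
inequality, so that a later discharge of the geometric genus of threefolds plugs in without touching these files. The
weakest input the tree's tools support is the `≤` half of PG FOR THE MEMBER `X_f` ITSELF,
`hpg3 : h^{3,0}(X_f) ≤ C(d−1,4)` for every nonsingular quinary `f` (inlined binder, no definition) — NOT the Fermat-only
inequality of route A's binder FGle: for threefolds `h^{3,0}` has no topological expression (Bx's odd-degree-surface trick
uses the signature), so it cannot be transported from the Fermat member; `h^{3,0}(X_f) ≥ C(d−1,4)` is the tree theorem
`choose_le_geometricGenus`, and with `hpg3` the residues at pole order one exhaust `H^{3,0}` equivariantly.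

This file is the verbatim copy of §3–§4 of the parent file with `hPG : Arapura2012_hypersurface_geometricGenus`
replaced by `hpg3` (PG ⟹ hpg3 trivially; the parent's PG-versions stay as landed):

* `finrank_signEigenspace_inf_piece_three_zero_of_genusBound` — `dim (E_c ∩ H^{3,0}) = box(d−5)` from `hpg3`;
* **`finrank_signEigenspace_inf_piece_of_genusBound`** — all four `ι`-eigen-Hodge numbers from `hpg3`.

## References

* [VoisinHodgeII2003] C. Voisin, Hodge Theory and Complex Algebraic Geometry II (2003), §6.1.3 Cor. 6.12.
* [Arapura2012] D. Arapura, Algebraic Geometry over the Complex Numbers (2012), §17.3 (17.3.1).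
* [Shioda1979HodgeFermat] T. Shioda, The Hodge conjecture for Fermat varieties, Math. Ann. 245 (1979), §1.
* [Katz2009] N. M. Katz, Another look at the Dwork family (2009), §3 Lemma 3.1(1).
-/

noncomputable section

open Finset MvPolynomial CategoryTheory
open Literature.AlgebraicGeometry.Motives Literature.AlgebraicGeometry.HodgeTheory
open Literature.AlgebraicGeometry.HodgeTheory.BettiUniverse
open Literature.AlgebraicGeometry.Motives.UniversalHypersurface
open Literature.AlgebraicTopology.SingularHomology

-- mandated namespace `Summit.HodgeConjecture.HodgeConjecture.Theorems` trips `linter.dupNamespace` (off tree-wide)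
set_option linter.dupNamespace false

namespace Summit.HodgeConjecture.HodgeConjecture.Theorems.SignSymmetricPowersSignEigenHodgeOfGenusBound

open Summit.HodgeConjecture.HodgeConjecture.Theorems.SignSymmetricPowersSignFermatCount
open Summit.HodgeConjecture.HodgeConjecture.Theorems.SignSymmetricPowersSignEigenHodgeOfGeometricGenus

/-! ### §1 `H^{3,0}`: residues at pole order one, granted `h^{3,0} ≤ C(d−1,4)` -/

/-- **`dim (E_c ∩ H^{3,0}(X_f)) = #{β ∈ [0,d−2]⁵ : |β| = d − 5, ι^β = c}`** (`0` for `d < 5`), granted ONLY the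
inequality `h^{3,0}(X_f) ≤ C(d−1,4)` (binder `hpg3`, the `≤` half of PG for smooth quinary forms, inlined):
for `d ≥ 5` the residues `Res(PΩ/f)`, `deg P = d − 5`, exhaust `H^{3,0}` (PG gives `h^{3,0} ≤ C(d−1,4) = dim S^{d−5}`;
`finrank_eigenspace_inf_piece_eq_of_finrank_piece_le`) equivariantly, and `(S^{d−5})_c` is counted by monomials
(`finrank_homogeneousSubmodule_inf_eigenspace`; the box bound `βᵢ ≤ d − 2` is automatic in degree `d − 5`); for `d = 4`,
`h^{3,0} = C(3,4) = 0`. [cite: VoisinHodgeII2003, §6.1.3 Cor. 6.12 (p = 1)] [cite: Arapura2012, §17.3 (17.3.1)] -/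
theorem finrank_signEigenspace_inf_piece_three_zero_of_genusBound
    (hpg3 : ∀ ⦃d : ℕ⦄ (f : MvPolynomial (Fin 5) ℂ), f.IsHomogeneous d → SmoothHypersurface.IsNonsingularForm ℂ f →
      ∀ (hXF : IsSmoothProjective 3 (SmoothHypersurface.hypersurface f)),
        Module.finrank ℂ ↥((hodge exists_isReal_hodgeModel_holds hXF 3).piece 3 0) ≤ (d - 1).choose 4) {d : ℕ} (h4 : 4 ≤ d)
    (f : MvPolynomial (Fin 5) ℂ) (hf : f.IsHomogeneous d) (hns : SmoothHypersurface.IsNonsingularForm ℂ f)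
    (hXF : IsSmoothProjective 3 (SmoothHypersurface.hypersurface f)) (ha : signInvolutionVector ∈ diagonalStabilizer f)
    (c : ℂ) :
    Module.finrank ℂ ↥(Module.End.eigenspace ((pull (diagonalAut f ha) 3).baseChange ℂ) c ⊓
        (hodge exists_isReal_hodgeModel_holds hXF 3).piece 3 0) =
      if (0 + 1) * d < 5 then 0 else
        (((univ : Finset (Fin 5)).finsuppAntidiag ((0 + 1) * d - 5)).filter
          fun β : Fin 5 →₀ ℕ ↦ (∀ i, β i ≤ d - 2) ∧
            (∏ i, ((signInvolutionVector i : ℂˣ) : ℂ) ^ β i) = c).card := by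
  classical
  by_cases hd5 : d < 5
  · -- `d = 4`: `h^{3,0} = C(3,4) = 0`
    rw [if_pos (by omega)]
    have hpg : Module.finrank ℂ ↥((hodge exists_isReal_hodgeModel_holds hXF 3).piece ((3 : ℕ) : ℤ) 0) = 0 := by
      have h := hpg3 f hf hns hXF
      have : d = 4 := by omega
      subst this
      exact Nat.le_zero.mp h
    haveI : Module.Finite ℚ ↥(bettiCohomology (SmoothHypersurface.hypersurface f) 3) := BettiUniverse.finite hXF 3
    refine le_antisymm ?_ (Nat.zero_le _)
    calc Module.finrank ℂ ↥(Module.End.eigenspace ((pull (diagonalAut f ha) 3).baseChange ℂ) c ⊓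
            (hodge exists_isReal_hodgeModel_holds hXF 3).piece 3 0)
        ≤ Module.finrank ℂ ↥((hodge exists_isReal_hodgeModel_holds hXF 3).piece ((3 : ℕ) : ℤ) 0) :=
          Submodule.finrank_mono inf_le_right
      _ = 0 := hpg
  · -- `d ≥ 5`: residues at pole order one exhaust `H^{3,0}`
    rw [if_neg (by omega)]
    have hd5' : 3 + 2 ≤ d := by omega
    have hpg : Module.finrank ℂ ↥((hodge exists_isReal_hodgeModel_holds hXF 3).piece ((3 : ℕ) : ℤ) 0) ≤
        Module.finrank ℂ ↥(homogeneousSubmodule (Fin (3 + 2)) ℂ (d - (3 + 2))) := by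
      rw [finrank_homogeneousSubmodule_sub_eq_choose (n := 3) hd5']
      exact hpg3 f hf hns hXF
    have h := finrank_eigenspace_inf_piece_eq_of_finrank_piece_le exists_isReal_hodgeModel_holds (n := 3) (by norm_num)
      hd5' hf hns hXF hpg ha c
    have h' : Module.finrank ℂ ↥(Module.End.eigenspace ((pull (diagonalAut f ha) 3).baseChange ℂ) c ⊓
        (hodge exists_isReal_hodgeModel_holds hXF 3).piece 3 0) =
        Module.finrank ℂ ↥(Module.End.eigenspace (twistedDiagonalAction signInvolutionVector) c ⊓
          homogeneousSubmodule (Fin 5) ℂ (d - 5)) := h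
    rw [h', ← eigenspace_aeval_diagonalSubst_eq_eigenspace_twistedDiagonalAction, prod_signInvolutionVector, inv_one,
      mul_one, inf_comm]
    have hcount : Module.finrank ℂ ↥(homogeneousSubmodule (Fin 5) ℂ (d - 5) ⊓
        Module.End.eigenspace (aeval (diagonalSubst signInvolutionVector)).toLinearMap c) =
        (((univ : Finset (Fin 5)).finsuppAntidiag (d - 5)).filter
          fun β : Fin 5 →₀ ℕ ↦ (∏ i, ((signInvolutionVector i : ℂˣ) : ℂ) ^ β i) = c).card :=
      finrank_homogeneousSubmodule_inf_eigenspace (n := 3) signInvolutionVector c (d - 5)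
    rw [hcount, show (0 + 1) * d - 5 = d - 5 by omega]
    refine congrArg Finset.card (Finset.filter_congr fun β hβ ↦ ?_)
    rw [mem_finsuppAntidiag] at hβ
    refine ⟨fun h ↦ ⟨fun i ↦ ?_, h⟩, fun h ↦ h.2⟩
    have hi : β i ≤ (univ : Finset (Fin 5)).sum ⇑β :=
      Finset.single_le_sum (f := ⇑β) (fun _ _ ↦ Nat.zero_le _) (Finset.mem_univ i)
    omega

/-! ### §2 The eigen-Hodge numbers from the genus bound -/

/-- **The `ι`-eigen-Hodge numbers of a smooth sign-symmetric threefold from the bound `h^{3,0} ≤ C(d−1,4)` alone**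
(the K1-B instance of the binder hV in box-count form): for even `d ≥ 4`, a nonsingular `ι`-invariant quinary form `f` of degree `d` with
`X_f` smooth projective, `j < 2`, `q ≤ 3`:
`dim_ℂ (E_{(−1)^j}(ι^* ⊗ ℂ) ∩ H^{3−q,q}(X_f)) = #{β ∈ [0,d−2]⁵ : |β| = (q+1)d − 5, ι^β = (−1)^j}` (`0` if `(q+1)d < 5`).
`q = 0` by residues at pole order one + PG; `q = 3` by Hodge symmetry; `q = 1, 2` from `b₃^± =
Σ_q h^{3−q,q}_±`, `b₃^±(X_f) = b₃^±(X³_d) = #{α ∈ 𝔄³_d : χ_α(ι) = ±1} = Σ_q box(q)` and the two symmetries.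
CONDITIONAL on the inlined bound `hpg3` only. [cite: VoisinHodgeII2003, §6.1.3 Cor. 6.12] [cite: Arapura2012, §17.3 (17.3.1)]
[cite: Shioda1979HodgeFermat, §1 (1.3)–(1.7)] [cite: Katz2009, §3 Lemma 3.1(1)] -/
theorem finrank_signEigenspace_inf_piece_of_genusBound
    (hpg3 : ∀ ⦃d : ℕ⦄ (f : MvPolynomial (Fin 5) ℂ), f.IsHomogeneous d → SmoothHypersurface.IsNonsingularForm ℂ f →
      ∀ (hXF : IsSmoothProjective 3 (SmoothHypersurface.hypersurface f)),
        Module.finrank ℂ ↥((hodge exists_isReal_hodgeModel_holds hXF 3).piece 3 0) ≤ (d - 1).choose 4)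
    ⦃d : ℕ⦄ (hd : Even d) (h4 : 4 ≤ d) (f : MvPolynomial (Fin 5) ℂ) (hf : f.IsHomogeneous d)
    (hns : SmoothHypersurface.IsNonsingularForm ℂ f) (hXF : IsSmoothProjective 3 (SmoothHypersurface.hypersurface f))
    (ha : signInvolutionVector ∈ diagonalStabilizer f) {j q : ℕ} (hj : j < 2) (hq : q ≤ 3) :
    Module.finrank ℂ ↥(Module.End.eigenspace ((pull (diagonalAut f ha) 3).baseChange ℂ) ((-1 : ℂ) ^ j) ⊓
        (hodge exists_isReal_hodgeModel_holds hXF 3).piece ((3 : ℤ) - q) q) =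
      if (q + 1) * d < 5 then 0 else
        (((univ : Finset (Fin 5)).finsuppAntidiag ((q + 1) * d - 5)).filter
          fun β : Fin 5 →₀ ℕ ↦ (∀ i, β i ≤ d - 2) ∧
            (∏ i, ((signInvolutionVector i : ℂˣ) : ℂ) ^ β i) = (-1 : ℂ) ^ j).card := by
  classical
  have h2 : 2 ≤ d := by omega
  haveI : NeZero d := ⟨by omega⟩
  set c : ℂ := (-1 : ℂ) ^ j with hcdef
  have hc : c = 1 ∨ c = -1 := by
    obtain rfl | rfl : j = 0 ∨ j = 1 := by omega
    · exact Or.inl (pow_zero _)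
    · exact Or.inr (pow_one _)
  have hconj : starRingEnd ℂ c = c := by
    rcases hc with h | h <;> rw [h] <;> simp
  set H := hodge exists_isReal_hodgeModel_holds hXF 3 with hH
  set E := Module.End.eigenspace ((pull (diagonalAut f ha) 3).baseChange ℂ) c with hE
  -- the box counts
  set G : ℕ → ℕ := fun q ↦ if (q + 1) * d < 5 then 0 else
    (((univ : Finset (Fin 5)).finsuppAntidiag ((q + 1) * d - 5)).filter
      fun β : Fin 5 →₀ ℕ ↦ (∀ i, β i ≤ d - 2) ∧
        (∏ i, ((signInvolutionVector i : ℂˣ) : ℂ) ^ β i) = c).card with hG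
  -- symmetries of the box: `G 3 = G 0`, `G 2 = G 1`
  have hιι : signInvolutionVector * signInvolutionVector = 1 := signUnits_mul_self 2
  have hprod : ∏ i, ((signInvolutionVector i : ℂˣ) : ℂ) ^ (d - 2) = 1 := by
    rw [Finset.prod_pow, prod_signInvolutionVector, one_pow]
  have hG03 : G 3 = G 0 := by
    by_cases hd5 : d < 5
    · have hd4 : d = 4 := by omega
      simp only [hG, if_neg (show ¬ (3 + 1) * d < 5 by omega), if_pos (show (0 + 1) * d < 5 by omega)]
      exact card_boxFilter_eq_zero_of_lt _ _ (by omega)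
    · simp only [hG, if_neg (show ¬ (3 + 1) * d < 5 by omega), if_neg (show ¬ (0 + 1) * d < 5 by omega)]
      exact card_boxFilter_eq_of_add_eq hιι hprod c (by omega)
  have hG12 : G 2 = G 1 := by
    simp only [hG, if_neg (show ¬ (2 + 1) * d < 5 by omega), if_neg (show ¬ (1 + 1) * d < 5 by omega)]
    exact card_boxFilter_eq_of_add_eq hιι hprod c (by omega)
  -- the four blocks
  have h0 : Module.finrank ℂ ↥(E ⊓ H.piece 3 0) = G 0 :=
    finrank_signEigenspace_inf_piece_three_zero_of_genusBound hpg3 h4 f hf hns hXF ha c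
  have h3 : Module.finrank ℂ ↥(E ⊓ H.piece 0 3) = G 0 := by
    rw [hE, hH, finrank_eigenspace_inf_piece_symm exists_isReal_hodgeModel_holds hXF (diagonalAut f ha) 3 c 0 3, hconj]
    exact h0
  have h12 : Module.finrank ℂ ↥(E ⊓ H.piece 1 2) = Module.finrank ℂ ↥(E ⊓ H.piece 2 1) := by
    rw [hE, hH, finrank_eigenspace_inf_piece_symm exists_isReal_hodgeModel_holds hXF (diagonalAut f ha) 3 c 1 2, hconj]
  -- `dim E = Σ_q dim (E ∩ H^{3−q,q})`
  have htot := finrank_eigenspace_baseChange_pull_eq_sum exists_isReal_hodgeModel_holds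
    hodgePQ_independent_of_hodgeModel_holds hXF (diagonalAut f ha) 3 c
  rw [Finset.sum_range_succ, Finset.sum_range_succ, Finset.sum_range_succ, Finset.sum_range_succ,
    Finset.sum_range_zero, zero_add] at htot
  have e0 : H.piece (((3 : ℕ) : ℤ) - ((0 : ℕ) : ℤ)) ((0 : ℕ) : ℤ) = H.piece 3 0 := by norm_num
  have e1 : H.piece (((3 : ℕ) : ℤ) - ((1 : ℕ) : ℤ)) ((1 : ℕ) : ℤ) = H.piece 2 1 := by norm_num
  have e2 : H.piece (((3 : ℕ) : ℤ) - ((2 : ℕ) : ℤ)) ((2 : ℕ) : ℤ) = H.piece 1 2 := by norm_num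
  have e3 : H.piece (((3 : ℕ) : ℤ) - ((3 : ℕ) : ℤ)) ((3 : ℕ) : ℤ) = H.piece 0 3 := by norm_num
  have htot' : Module.finrank ℂ ↥E = Module.finrank ℂ ↥(E ⊓ H.piece 3 0) + Module.finrank ℂ ↥(E ⊓ H.piece 2 1) +
      Module.finrank ℂ ↥(E ⊓ H.piece 1 2) + Module.finrank ℂ ↥(E ⊓ H.piece 0 3) := by
    rw [← e0, ← e1, ← e2, ← e3]; exact htot
  -- `dim E = #{α ∈ 𝔄 : χ_α(ι) = c} = Σ_q G q`
  have hbetti : Module.finrank ℂ ↥E = G 0 + G 1 + G 2 + G 3 := by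
    rw [hE, finrank_signEigenspace_eq_card_admissible hd f hf hns hXF ha c,
      card_admissible_character_eq_sum_boxFilter h2 ⟨signInvolutionVector, signInvolutionVector_mem_fermatGroup hd⟩
        prod_signInvolutionVector c,
      Finset.sum_range_succ, Finset.sum_range_succ, Finset.sum_range_succ, Finset.sum_range_succ,
      Finset.sum_range_zero, zero_add]
  -- hence `dim (E ∩ H^{2,1}) = G 1`
  have h1 : Module.finrank ℂ ↥(E ⊓ H.piece 2 1) = G 1 := by omega
  -- the four cases
  obtain rfl | rfl | rfl | rfl : q = 0 ∨ q = 1 ∨ q = 2 ∨ q = 3 := by omega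
  · rw [show H.piece ((3 : ℤ) - ((0 : ℕ) : ℤ)) ((0 : ℕ) : ℤ) = H.piece 3 0 by norm_num]
    exact h0
  · rw [show H.piece ((3 : ℤ) - ((1 : ℕ) : ℤ)) ((1 : ℕ) : ℤ) = H.piece 2 1 by norm_num]
    exact h1
  · rw [show H.piece ((3 : ℤ) - ((2 : ℕ) : ℤ)) ((2 : ℕ) : ℤ) = H.piece 1 2 by norm_num, h12, h1]
    exact hG12.symm
  · rw [show H.piece ((3 : ℤ) - ((3 : ℕ) : ℤ)) ((3 : ℕ) : ℤ) = H.piece 0 3 by norm_num, h3]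
    exact hG03.symm

end Summit.HodgeConjecture.HodgeConjecture.Theorems.SignSymmetricPowersSignEigenHodgeOfGenusBound

end
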